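import Summits.HodgeConjecture.HodgeConjecture.Theorems.Ring2DeformQbarDescent
import Summits.HodgeConjecture.HodgeConjecture.Theorems.Ring2DeformUniformAlgebraicity
import Summits.HodgeConjecture.HodgeConjecture.Theorems.Ring2AbelianAllFrameCrossBranch
import Literature.AlgebraicGeometry.HodgeTheory.AlgebraicityLocus
import HarnessLib

/-!
# Ring 2 · route `deform`, XVI — `ℚ̄`-SPREADING (row Q): algebraicity spread from the fibres over `ℚ̄`-POINTS of a
# `ℚ̄`-defined abelian family instead of from CM points (row U); the geometric factor `Spread_AV` of the item
# (part XV) REPLACED by a typed Principle-B statement over `ℚ̄`; `HC_AV ⟺ HC_QbarAV ∧ Q ⟺ HC_CM ∧ L(𝔇) ∧ Q` modulo print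

HONEST FRAMING: research route conditional on HC_CM; not a corollary; Q11.4-sentence-2 already refuted in dim ≥ 3.

Cell `pub-hodge-ring2`, seat `pub-hodge-ring2-deform` (gen 21). `HC_CM` := `Theses.RankFourFaces.CMAbelianHodge`
(stmt-HodgeConjecture-3052) is a BINDER (§E) and never a fact; `HC_AV` := `Theses.PadicSemiregularLift.HodgeAbelianVarieties`
(stmt-1333); `HC_QbarAV` := part V's endpoint `HodgeConjectureQbarAV` (Hodge for abelian varieties definable over
`ℚ^al ⊂ ℂ`); the item `Theses.RankFourFaces.CMToAbelian` (stmt-HodgeConjecture-16267) is OPEN and nothing here closes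
it: §E gives it an exact form. Nothing in this file proves a case of the Hodge conjecture. RING2-MAP D.72–D.75.

THE QUESTION OF THIS PART (cell brief (ii), arithmetic reading). Part XV factored the item as `Spread_AV ∧ (HC_CM → L(𝔇))`
with `Spread_AV := HC_QbarAV → HC_AV` ("Hodge over `ℚ̄` ⟹ Hodge over `ℂ` for abelian varieties") an OPAQUE implication
between two conjectures. Here `Spread_AV` is opened up on the carriers of `Literature/…/AlgebraicityLocus` (an
embedding `σ : ℚ̄ →+* ℂ`, a `ℚ̄`-morphism `f₀ : 𝒳₀ ⟶ S₀`, its complexification `f = f₀ ⊗_σ ℂ`, the projection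
`S ⟶ S₀`): WHAT spreads algebraicity from the fibres over the `ℚ̄`-POINTS of `S₀` — where `HC_QbarAV` acts — to every
complex fibre? Answer, typed: the node **`QbarSpreading` (Q)** — on a `ℚ̄`-family of abelian varieties, a global
fibrewise-Hodge class algebraic on EVERY fibre over a closed point of `S₀` is algebraic on every fibre. It is row U
(part II-b) with the dense CM locus replaced by the Zariski-dense (`S₀` is Jacobson, §A) set of `ℚ̄`-points, and the
anchor supply `HC_CM` replaced by `HC_QbarAV` — itself `HC_CM ∧ L(𝔇)` modulo print (parts V, XV).

THE ONE PRINTED INPUT, as the node `QbarHodgeFamilies` (THEOREM IN PRINT, assembled; OPEN in Lean — exactly the status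
part II-b gave `CMDenseMumfordTateFamilies` before the literature seat vendored it): for a complex abelian variety `A`
and a Hodge class `c` on it there are `σ`, a `ℚ̄`-family of abelian varieties `f₀ : 𝒳₀ ⟶ S₀` (smooth irreducible
quasi-projective over `ℚ̄`, fibres over closed points abelian varieties over `ℚ̄`), a point `s₁ ∈ S(ℂ)` with
`A ≅ 𝒳_{s₁}` and a global class `W` on `𝒳(ℂ)`, fibrewise a rational `(p,p)`-class, restricting to `c`. PRINT:
[Deligne1982HodgeCycles, Thm. 2.11] (Hodge classes on abelian varieties are absolute Hodge); [Voisin2007HodgeLoci,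
§3, proof of Prop. 1.2, first paragraph (arXiv p. 6)], verbatim: "Let (X^{an}, α) be a pair consisting of a projective
complex manifold and an absolute … rational Hodge class. … there exist smooth irreducible quasi-projective varieties
𝒳, T defined over ℚ̄, a projective morphism π : 𝒳 → T, and a locally constant global section α̃ ∈ H⁰(T, R^{2k}π_*ℚ),
such that X is one fiber of π and α is the restriction of α̃ to this fiber" (T a component of the `ℚ̄`-closure of the
Hodge locus of α inside "a family of deformations of X, which is defined over ℚ (here T is not supposed to be
geometrically irreducible, and thus the assumption is not restrictive on X)", §2 p. 4 — for `X = A` a family of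
ABELIAN VARIETIES over a `ℚ`-variety with `A` a complex fibre (a spread of `A` [EGAIV3, Thm. 8.8.2 and 8.10.5], or the
universal family over a fine moduli scheme of polarised abelian varieties with level structure [MumfordGIT, Ch. 7,
Thm. 7.9]), so that `π` is an abelian scheme: complex fibres are abelian varieties and the fibre over a closed point
`x ∈ T` is an abelian variety over `κ(x) = ℚ̄` whose base change along `σ` is `𝒳_t`, EGA I 3.3 transitivity); `α̃_t` is a Hodge class for every `t ∈ T(ℂ)` (T lies in the locus of Hodge
classes) and `α̃` lifts to a global class: "Deligne's global invariant cycle theorem [de2] says now that for any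
smooth completion 𝒳̄ of 𝒳, there exists a Hodge class β ∈ Hdg^{2k}(𝒳̄) such that β|_X = α" [DeligneHodgeII1971,
Thm. 4.1.1] (`W := β|_𝒳`). NOT asserted; an explicit hypothesis `hE` of every row.

## What is typed (hypotheses, `@[conjecture]`, never asserted) and what is proved (kernel, unconditional)

§A `qbarLocus σ S₀ ⊆ S(ℂ)`: the complex points over CLOSED points of `S₀` (= `S₀(ℚ̄)`, Nullstellensatz). Proved:
   non-empty once `S(ℂ)` is, and a closed `Z ⊆ S₀` under all of it is `S₀` (Jacobson: Mathlib `closure_closedPoints`)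
   — the ONLY thing the `ℚ̄`-structure gives for free. No Baire argument: `S₀(ℚ̄)` is countable, so countably many
   PROPER `ℚ̄`-closed strata (Voisin's structure fact `voisin2007_algebraicityLocus_iUnion_qbarClosed`) may cover it.
§B nodes `QbarSpreading` (Q) and `QbarHodgeFamilies` (`hE`), hypotheses SPELLED OUT (no bundling definition).
§C ON PATH / ORDER: `AbelianSchemeVHC ⟹ Q` (one anchor over a closed point suffices there), hence `HC_AV ⟹ Q`,
   `HodgeConjecture ⟹ Q`; Voisin's road `AbsoluteHodgeImpliesAlgebraicQbar ⟹ Q` [Deligne + Voisin tree facts].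
§D ROW Q: `HC_AV_of_hodgeConjectureQbarAV_of_qbarSpreading (hE) : HC_QbarAV → Q → HC_AV`; EXACT:
   `HC_AV ↔ HC_QbarAV ∧ Q` [hE]; under the endpoint `Q ↔ HC_AV`; `Spread_AV ⟸ Q`, and in the LEAD's grid
   `PivotAV (HC_QbarAV ∧ Q)`.
§E `HC_CM` ROWS (parts V + XV + Q): `HC_AV_of_HC_CM_of_spanLifting_of_qbarSpreading (𝔇) (hJ) (hE) : HC_CM → L(𝔇) → Q →
   HC_AV`; EXACT `HC_AV ↔ HC_CM ∧ L(𝔇) ∧ Q` modulo [`hJ` = Milne 1999 Thm 7.1 + Deligne 1982 2.9(b), `hE`] — an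
   exactness row for `HC_AV` on the ARITHMETIC axis whose geometric complement is a Principle-B-shaped statement on
   published carriers instead of part XV's bare implication `Spread_AV`; rational form with `R₁(𝔇)`; frame words `ExactWithCM`/`ClosesWithCM (L ∧ Q)`, `OnPathAV Q`; and THE ITEM
   EXACTLY: `CMToAbelian ↔ ModCM (L(𝔇) ∧ Q)` [hJ, hE] — stmt-16267 is "under `HC_CM`: Tate-side span lifting at almost
   all primes for abelian varieties over `ℚ̄` AND `ℚ̄`-spreading", no descent `hdesc` needed.

HONEST COLUMN. (1) KIND of Q (premise rule, RING2-MAP §VI-bis): premise = algebraic at ALL `ℚ̄`-fibres, fed by nothing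
in print short of Hodge over `ℚ̄` (`HC_QbarAV`, or Voisin's `AbsoluteHodgeImpliesAlgebraicQbar`); neither `Q ⟹ HC_QbarAV`
nor `HC_QbarAV ⟹ Q` is visible, and neither `Q ⟹ HC_AV` nor `HC_QbarAV ⟹ HC_AV` (= `Spread_AV`, open): a genuine
splitting, KIND 2 as typed — with the standing caveat that a strengthening "algebraic on a Zariski-dense set of
`ℚ̄`-fibres ⟹ everywhere" would be fed unconditionally on families whose known-HC `ℚ̄`-points are dense. Next to
`HC_CM`, Q alone closes nothing (`ClosesWithCM Q` is not claimed); the closing complement is `L(𝔇) ∧ Q`. (2) Q is NOT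
in print and may FAIL for cycle-theoretic reasons invisible to Hodge theory: spreading a cycle from closed fibres to
the generic fibre needs a uniform bound on the degree of representing cycles over `S₀(ℚ̄)` (finitely many Hilbert
strata) — exactly the effectivity the Hodge conjecture over `ℚ̄` does not provide; Galois permutes Voisin's strata but
forces none to be `S₀`. What WOULD prove it: `AbelianSchemeVHC` (§C), or closedness of the algebraicity locus on
`ℚ̄`-abelian families (Q's uniform form with `Z` produced by relative Hilbert schemes). (3) No implication between U (dense CM
locus, complex families) and Q (`ℚ̄`-points, `ℚ̄`-families) is claimed. (4) Survives Q11.4-sentence-2's refutation: no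
secant / degeneration statement occurs. (5) New mathematics: none — transport and bookkeeping; the value is the typed
node, the exact rows and the placement of `Spread_AV`'s content on published carriers.
-/

set_option linter.dupNamespace false

namespace Summit.HodgeConjecture.HodgeConjecture.Ring2.Deform

open CategoryTheory AlgebraicGeometry
open Literature.AlgebraicGeometry Literature.AlgebraicGeometry.Motives
open Literature.AlgebraicGeometry.HodgeTheory
open Literature.AlgebraicTopology.SingularHomology
open Summit.HodgeConjecture.HodgeConjecture
open Summit.HodgeConjecture.HodgeConjecture.Theses
open Summit.HodgeConjecture.HodgeConjecture.Theses.RankFourFaces (CMAbelianHodge CMToAbelian)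
open Summit.HodgeConjecture.HodgeConjecture.Theses.PadicSemiregularLift (HodgeAbelianVarieties)
open Summit.HodgeConjecture.HodgeConjecture.Ring2.Hypotheses (AbelianSchemeVHC AbsoluteHodgeImpliesAlgebraicQbar)
open Summit.HodgeConjecture.HodgeConjecture.Ring2.AbelianAll (ClosesWithCM OnPathAV ExactWithCM CMIdle ModCM PivotAV
  pivotAV_iff closesWithCM_cmToAbelian)
open Summit.HodgeConjecture.HodgeConjecture.Theorems.HodgeAbelianVarieties.Negative (iff_hodgeConjecture_restricted)

/-! ## §A The `ℚ̄`-locus of a complexified `ℚ̄`-scheme and what the `ℚ̄`-structure gives for free -/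

section QbarLocus

variable (σ : AlgebraicClosure ℚ →+* ℂ) (S₀ : SchemeOver (AlgebraicClosure ℚ))

/-- **The `ℚ̄`-locus** of `S = S₀ ⊗_σ ℂ` (a `Set`-valued definition, not an assertion): the complex points of `S` lying
over a CLOSED point of `S₀` under the projection `S ⟶ S₀` (`Motives.baseChangeHomFst`). For `S₀` locally of finite
type over `ℚ̄` these are the points coming from `S₀(ℚ̄)` (Hilbert's Nullstellensatz, Mathlib `pointOfClosedPoint`;
`AlgebraicityLocus.exists_base_pt_eq_of_isClosed`). [cite: Hartshorne1977, Ch. II Ex. 3.14 and Ch. I Cor. 1.4] -/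
def qbarLocus : Set (ComplexPoints ((baseChangeHom σ).obj S₀)) :=
  {t | IsClosed ({(baseChangeHomFst σ S₀).base t.pt} : Set S₀.left)}

variable {σ S₀}

/-- Membership in the `ℚ̄`-locus, by definition. [folklore] -/
theorem mem_qbarLocus_iff (t : ComplexPoints ((baseChangeHom σ).obj S₀)) :
    t ∈ qbarLocus σ S₀ ↔ IsClosed ({(baseChangeHomFst σ S₀).base t.pt} : Set S₀.left) := Iff.rfl

/-- **Every closed point of a quasi-projective `S₀/ℚ̄` lies under the `ℚ̄`-locus** (Nullstellensatz: closed points are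
`ℚ̄`-rational; `exists_base_pt_eq_of_isClosed`). [cite: Hartshorne1977, Ch. II Ex. 3.14] -/
theorem exists_mem_qbarLocus_base_pt_eq (hS₀ : IsQuasiProjectiveOver S₀) (x : S₀.left)
    (hx : IsClosed ({x} : Set S₀.left)) :
    ∃ t ∈ qbarLocus σ S₀, (baseChangeHomFst σ S₀).base t.pt = x := by
  haveI : LocallyOfFiniteType S₀.hom := locallyOfFiniteType_of_isQuasiProjectiveOver hS₀
  obtain ⟨t, ht⟩ := exists_base_pt_eq_of_isClosed σ x hx
  exact ⟨t, by rwa [mem_qbarLocus_iff, ht], ht⟩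

/-- **The `ℚ̄`-locus is non-empty as soon as `S(ℂ)` is** (`S₀` quasi-projective over `ℚ̄`, hence Jacobson: a non-empty
scheme locally of finite type over a field has a closed point, Mathlib `nonempty_inter_closedPoints`). [folklore] -/
theorem qbarLocus_nonempty (hS₀ : IsQuasiProjectiveOver S₀) (t : ComplexPoints ((baseChangeHom σ).obj S₀)) :
    (qbarLocus σ S₀).Nonempty := by
  haveI : LocallyOfFiniteType S₀.hom := locallyOfFiniteType_of_isQuasiProjectiveOver hS₀
  haveI : JacobsonSpace S₀.left := LocallyOfFiniteType.jacobsonSpace S₀.hom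
  obtain ⟨x, -, hx⟩ := nonempty_inter_closedPoints (X := S₀.left)
    ⟨(baseChangeHomFst σ S₀).base t.pt, Set.mem_univ _⟩ isOpen_univ.isLocallyClosed
  obtain ⟨s, hs, -⟩ := exists_mem_qbarLocus_base_pt_eq hS₀ x ((mem_closedPoints_iff).1 hx)
  exact ⟨s, hs⟩

/-- **`ℚ̄`-points are Zariski dense — the only free input of the row.** A closed subset of a quasi-projective `S₀/ℚ̄`
lying under every point of the `ℚ̄`-locus is all of `S₀` (it contains every closed point, and closed points are dense
in a Jacobson space, Mathlib `closure_closedPoints`). [cite: Hartshorne1977, Ch. II Ex. 3.14] -/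
theorem eq_univ_of_isClosed_of_qbarLocus (hS₀ : IsQuasiProjectiveOver S₀) {Z : Set S₀.left} (hZ : IsClosed Z)
    (h : ∀ t ∈ qbarLocus σ S₀, (baseChangeHomFst σ S₀).base t.pt ∈ Z) : Z = Set.univ := by
  haveI : LocallyOfFiniteType S₀.hom := locallyOfFiniteType_of_isQuasiProjectiveOver hS₀
  haveI : JacobsonSpace S₀.left := LocallyOfFiniteType.jacobsonSpace S₀.hom
  have hcl : closedPoints S₀.left ⊆ Z := fun x hx ↦ by
    obtain ⟨t, ht, htx⟩ := exists_mem_qbarLocus_base_pt_eq (σ := σ) hS₀ x ((mem_closedPoints_iff).1 hx)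
    exact htx ▸ h t ht
  exact Set.eq_univ_of_univ_subset ((closure_closedPoints (X := S₀.left)) ▸ closure_minimal hcl hZ)

end QbarLocus

/-! ## §B The nodes: `ℚ̄`-families of abelian varieties, `QbarSpreading` (Q), `QbarHodgeFamilies` (`hE`) -/

/-- **`QbarSpreading` (Q) — algebraicity spreads from the `ℚ̄`-fibres of a `ℚ̄`-family of abelian varieties.** For every
embedding `σ : ℚ̄ →+* ℂ`, every `ℚ̄`-FAMILY OF ABELIAN VARIETIES `f₀ : 𝒳₀ ⟶ S₀` of relative dimension `n` (`𝒳₀`, `S₀`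
quasi-projective over `ℚ̄`, `S₀` irreducible, the complexified base `S = S₀ ⊗_σ ℂ` irreducible and smooth, `f = f₀ ⊗_σ ℂ`
a smooth projective family, every complex fibre charted by an abelian variety — Voisin's "smooth irreducible
quasi-projective varieties 𝒳, T defined over ℚ̄, a projective morphism π : 𝒳 → T" on the tree's carriers, i.e.
`AbelianSchemeVHC`'s hypotheses plus the `ℚ̄`-structure) and every global class `W ∈ H²ᵖ(𝒳(ℂ); ℂ)` that is fibrewise
a rational `(p,p)`-class: if `W|_{𝒳_t}` is algebraic for every `t ∈ S(ℂ)`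
over a CLOSED point of `S₀` (`qbarLocus`), then `W|_{𝒳_t}` is algebraic for every `t ∈ S(ℂ)`. The `ℚ̄`-point analogue
of row U's `UniformAlgebraicityAtCMPoints` (dense CM locus ↦ Zariski-dense `ℚ̄`-locus) and the typed content of part
XV's `Spread_AV` (§D). Premise at ALL `ℚ̄`-fibres = the weakest form closing the row (module docstring, HONEST COLUMN
(1)–(2)). Implied by `AbelianSchemeVHC`, by `HC_AV` (§C); NOT in print; no Baire route (countably many `ℚ̄`-points). Modulo
Voisin's structure fact its content is the passage CLOSED POINTS ⟹ GENERIC POINT of `S₀`: one fibre over the generic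
point with algebraic class gives all fibres (`voisin2007_algebraicityLocus_iUnion_qbarClosed.mem_of_base_pt_eq_genericPoint`,
Charles–Schnell Lemma 11.3.14); and it is equivalent to its UNIFORM form "one closed `Z ⊆ S₀` of algebraic fibres
lies under the `ℚ̄`-locus" by `eq_univ_of_isClosed_of_qbarLocus` (as U ↔ spreading in part II-b).
Nearest print: Voisin's structure theorem (algebraicity locus = countable union of closed `ℚ̄`-subvarieties, tree fact
`voisin2007_algebraicityLocus_iUnion_qbarClosed`) and her reduction of HC for absolute Hodge classes to `ℚ̄` through
TOTAL SPACES (Prop. 1.2) — neither gives it. NOT asserted. [cite: Voisin2007HodgeLoci, §0 first paragraph, Prop. 1.2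
and §3 (p. 6)] [cite: CharlesSchnell2014Notes, Conj. 11.3.1, Prop. 11.3.11 and Lemma 11.3.14] [status: open] -/
@[conjecture] def QbarSpreading : Prop :=
  ∀ (σ : AlgebraicClosure ℚ →+* ℂ) ⦃𝒳₀ S₀ : SchemeOver (AlgebraicClosure ℚ)⦄ (f₀ : 𝒳₀ ⟶ S₀) (n : ℕ),
    IsQuasiProjectiveOver 𝒳₀ → IsQuasiProjectiveOver S₀ → IrreducibleSpace S₀.left →
    IrreducibleSpace ((baseChangeHom σ).obj S₀).left → AlgebraicGeometry.Smooth ((baseChangeHom σ).obj S₀).hom →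
    IsSmoothProjectiveFamily ((baseChangeHom σ).map f₀) n →
    (∀ t : ComplexPoints ((baseChangeHom σ).obj S₀),
      ∃ A' : AbelianVariety ℂ, A'.dim = n ∧ Nonempty (A'.X ≅ fiberOver ((baseChangeHom σ).map f₀) t)) →
    ∀ (p : ℕ) (W : complexBetti ((baseChangeHom σ).obj 𝒳₀) (2 * p)),
      (∀ t : ComplexPoints ((baseChangeHom σ).obj S₀),
        IsRationalClass (complexBetti.map (fiberι ((baseChangeHom σ).map f₀) t) (2 * p) W) ∧
        IsOfHodgeType n (fiberOver ((baseChangeHom σ).map f₀) t) (2 * p) p p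
          (complexBetti.map (fiberι ((baseChangeHom σ).map f₀) t) (2 * p) W)) →
      (∀ t ∈ qbarLocus σ S₀, complexBetti.map (fiberι ((baseChangeHom σ).map f₀) t) (2 * p) W ∈
          algebraicClasses (fiberOver ((baseChangeHom σ).map f₀) t) p) →
      ∀ t : ComplexPoints ((baseChangeHom σ).obj S₀),
        complexBetti.map (fiberι ((baseChangeHom σ).map f₀) t) (2 * p) W ∈
          algebraicClasses (fiberOver ((baseChangeHom σ).map f₀) t) p

/-- **`QbarHodgeFamilies` (`hE`) — every Hodge class on a complex abelian variety sits in a `ℚ̄`-FAMILY OF ABELIAN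
VARIETIES with a global fibrewise-Hodge extension (THEOREM IN PRINT, assembled; OPEN hypothesis in Lean).** For `A/ℂ`
abelian and `c ∈ H²ᵖ(A; ℂ)` rational of type `(p,p)`: there are `σ : ℚ̄ →+* ℂ`, a `ℚ̄`-family of abelian varieties
`f₀ : 𝒳₀ ⟶ S₀` of relative dimension `dim A` (hypotheses as in `QbarSpreading`) whose fibres over the `ℚ̄`-locus are
complexifications of abelian varieties over `ℚ^al ⊂ ℂ` (part V's carrier), a point `s₁ ∈ S(ℂ)` with `e : A ≅ 𝒳_{s₁}`,
and a global class `W` on `𝒳(ℂ)`, fibrewise rational of type `(p,p)`, with `e^*(W|_{𝒳_{s₁}}) = c`. Assembled from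
Deligne (Hodge classes on abelian varieties are absolute Hodge), Voisin (families over the `ℚ̄`-closure of the Hodge
locus of an absolute Hodge class, verbatim in the module docstring), Deligne's global invariant cycles (the flat
section lifts to a global class) and a family of abelian varieties over a `ℚ`-variety through `A` as the deformation
family (a spread of `A`, or the universal family over a fine moduli scheme; so that all fibres are abelian varieties,
those over closed points defined over `ℚ̄`). The `ℚ̄`-analogue of the vendored `CMDenseMumfordTateFamilies` (dense CM
locus ↦ `ℚ̄`-structure). NOT a case of HC; NOT asserted; the binder `hE` of §D–§E.
[cite: Deligne1982HodgeCycles, Thm. 2.11] [cite: Voisin2007HodgeLoci, §2 (p. 4) and §3 proof of Prop. 1.2 (p. 6)]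
[cite: DeligneHodgeII1971, Thm. 4.1.1] [cite: EGAIV3, Thm. 8.8.2 and 8.10.5] [cite: MumfordGIT, Ch. 7 Thm. 7.9] [status: open] -/
@[conjecture] def QbarHodgeFamilies : Prop :=
  ∀ (A : AbelianVariety ℂ), IsSmoothProjective A.dim A.X →
    ∀ (p : ℕ) (c : complexBetti A.X (2 * p)), IsRationalClass c → IsOfHodgeType A.dim A.X (2 * p) p p c →
      ∃ (σ : AlgebraicClosure ℚ →+* ℂ) (𝒳₀ S₀ : SchemeOver (AlgebraicClosure ℚ)) (f₀ : 𝒳₀ ⟶ S₀)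
        (s₁ : ComplexPoints ((baseChangeHom σ).obj S₀)) (e : A.X ≅ fiberOver ((baseChangeHom σ).map f₀) s₁)
        (W : complexBetti ((baseChangeHom σ).obj 𝒳₀) (2 * p)),
        IsQuasiProjectiveOver 𝒳₀ ∧ IsQuasiProjectiveOver S₀ ∧ IrreducibleSpace S₀.left ∧
        IrreducibleSpace ((baseChangeHom σ).obj S₀).left ∧ AlgebraicGeometry.Smooth ((baseChangeHom σ).obj S₀).hom ∧
        IsSmoothProjectiveFamily ((baseChangeHom σ).map f₀) A.dim ∧
        (∀ t : ComplexPoints ((baseChangeHom σ).obj S₀),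
          ∃ A' : AbelianVariety ℂ, A'.dim = A.dim ∧ Nonempty (A'.X ≅ fiberOver ((baseChangeHom σ).map f₀) t)) ∧
        (∀ t ∈ qbarLocus σ S₀, ∃ A₀ : AbelianVariety (IntermediateField.toSubfield (algebraicClosure ℚ ℂ)),
          A₀.dim = A.dim ∧ Nonempty ((A₀.baseChange ℂ).X ≅ fiberOver ((baseChangeHom σ).map f₀) t)) ∧
        (∀ t : ComplexPoints ((baseChangeHom σ).obj S₀),
          IsRationalClass (complexBetti.map (fiberι ((baseChangeHom σ).map f₀) t) (2 * p) W) ∧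
          IsOfHodgeType A.dim (fiberOver ((baseChangeHom σ).map f₀) t) (2 * p) p p
            (complexBetti.map (fiberι ((baseChangeHom σ).map f₀) t) (2 * p) W)) ∧
        complexBetti.map e.hom (2 * p) (complexBetti.map (fiberι ((baseChangeHom σ).map f₀) s₁) (2 * p) W) = c

/-! ## §C On path and order: `AbelianSchemeVHC ⟹ Q`, `HC_AV ⟹ Q`, Voisin's road ⟹ Q -/

/-- **`AbelianSchemeVHC ⟹ Q`**: the `ℚ̄`-locus is non-empty (`qbarLocus_nonempty`), ONE of its fibres is an algebraic
anchor, and the variational input of part I transports to every fibre. Q is WEAKER than blanket VHC (it is given a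
Zariski-dense set of anchors, not one). [cite: CharlesSchnell2014Notes, Conj. 11.3.1] -/
theorem qbarSpreading_of_abelianSchemeVHC (hV : AbelianSchemeVHC) : QbarSpreading := by
  intro σ 𝒳₀ S₀ f₀ n _ hS₀ _ hirr hsm hf hab p W hW hq t
  obtain ⟨s₀, hs₀⟩ := qbarLocus_nonempty hS₀ t
  exact hV _ hf hirr hsm hab p W hW ⟨s₀, hq s₀ hs₀⟩ t

/-- ON PATH: `HC_AV ⟹ Q` (through `AbelianSchemeVHC ⟸ HC_AV`, part I). [cite: CharlesSchnell2014Notes, Cor. 11.3.6] -/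
theorem qbarSpreading_of_HC_AV (h : HodgeAbelianVarieties) : QbarSpreading :=
  qbarSpreading_of_abelianSchemeVHC (abelianSchemeVHC_of_HC_AV h)

/-- ON PATH: `HodgeConjecture ⟹ Q`. [folklore] -/
theorem qbarSpreading_of_hodgeConjecture (h : _root_.HodgeConjecture) : QbarSpreading :=
  qbarSpreading_of_HC_AV (HC_AV_of_hodgeConjecture h)

/-- In the LEAD's grammar: `OnPathAV Q`. [folklore] -/
theorem onPathAV_qbarSpreading : OnPathAV QbarSpreading := qbarSpreading_of_HC_AV

/-- **Voisin's road is STRONGER input than Q**: "absolute Hodge classes are algebraic on smooth projective varieties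
over `ℚ̄`" (`Hypotheses.AbsoluteHodgeImpliesAlgebraicQbar`, Voisin's hypothesis in Prop. 1.2, about TOTAL SPACES, not
abelian varieties) gives `HC_AV` by the tree facts of Deligne (Thm. 2.11) and Voisin (Prop. 1.2), hence Q. Row Q
replaces that hypothesis by `HC_QbarAV ∧ Q`. [cite: Voisin2007HodgeLoci, Prop. 1.2 and Rem. 1.4] [cite: Deligne1982HodgeCycles, Thm. 2.11] -/
theorem qbarSpreading_of_absoluteHodgeImpliesAlgebraicQbar (hD : deligne1982_hodgeClasses_abelianVariety_absoluteHodge)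
    (hV : voisin2007_hodgeConjecture_absolute_of_qbar) (h : AbsoluteHodgeImpliesAlgebraicQbar) : QbarSpreading :=
  qbarSpreading_of_HC_AV (Hypotheses.hc_av_of_deligne_of_voisin_of_absoluteHodgeImpliesAlgebraicQbar hD hV h)

/-! ## §D ROW Q — `HC_AV` from Hodge over `ℚ̄` for abelian varieties and `ℚ̄`-spreading -/

/-- **`HC_QbarAV` at a `ℚ̄`-charted fibre** — the ONLY place the arithmetic endpoint is consumed: a rational
`(p,p)`-class on `X ≅ (A₀ ⊗ ℂ)` with `A₀/ℚ^al` is algebraic under `HC_QbarAV` (transport along the chart, as typer2's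
`mem_algebraicClasses_of_cmChart` does for `HC_CM`). [cite: GrothendieckTopology1969, §1] -/
theorem mem_algebraicClasses_of_qbarChart (hQ : HodgeConjectureQbarAV) {X : SchemeOver ℂ} {N p : ℕ}
    (A₀ : AbelianVariety (IntermediateField.toSubfield (algebraicClosure ℚ ℂ))) (e₀ : (A₀.baseChange ℂ).X ≅ X)
    (hdim : A₀.dim = N) {x : complexBetti X (2 * p)} (hxQ : IsRationalClass x) (hxH : IsOfHodgeType N X (2 * p) p p x) :
    x ∈ algebraicClasses X p := by
  have hHC : HodgeConjectureFor A₀.dim (A₀.baseChange ℂ).X := hQ A₀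
  subst hdim
  exact (mem_algebraicClasses_map_iff_of_iso e₀).1
    (hHC.2 p _ ((isRationalClass_map_iff_of_iso e₀).2 hxQ) ((isOfHodgeType_map_iff_of_iso e₀).2 hxH))

/-- **ROW Q — `HC_AV_of_hodgeConjectureQbarAV_of_qbarSpreading`.** `HC_QbarAV ∧ Q ⟹ HC_AV` modulo the printed families
`hE`: given a Hodge class `c` on `A`, take the `ℚ̄`-family through `(A, c)` (`hE`); `HC_QbarAV` makes `W` algebraic at
EVERY fibre over the `ℚ̄`-locus (`mem_algebraicClasses_of_qbarChart`); Q spreads this to all fibres, in particular to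
`𝒳_{s₁} ≅ A`. Deligne's Principle-B reduction with "absolute Hodge" replaced by "algebraic", CM points by `ℚ̄`-points
and the closedness Principle B enjoys by its honest algebraic counterpart Q. CONDITIONAL on `HC_QbarAV` (OPEN; =
`HC_CM ∧ L(𝔇)` modulo print, §E), on `hE` (print, unformalised) and on Q (OPEN, no print).
[cite: Deligne1982HodgeCycles, Thm. 2.11 and Thm. 2.12] [cite: Voisin2007HodgeLoci, §3 proof of Prop. 1.2 (p. 6)] -/
theorem HC_AV_of_hodgeConjectureQbarAV_of_qbarSpreading (hE : QbarHodgeFamilies) (hQb : HodgeConjectureQbarAV)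
    (hQ : QbarSpreading) : HodgeAbelianVarieties := by
  refine iff_hodgeConjecture_restricted.2 fun A hA ↦ ?_
  refine (hodgeConjectureFor_iff_of_isSmoothProjective nonempty_hodgeModel_holds hA).2 ?_
  intro p c hc hpp
  obtain ⟨σ, 𝒳₀, S₀, f₀, s₁, e, W, h𝒳₀, hS₀, hirr₀, hirr, hsm, hf, hab, hchart, hW, hWc⟩ := hE A hA p c hc hpp
  -- `HC_QbarAV` at every fibre over a closed point of `S₀`
  have hq : ∀ t ∈ qbarLocus σ S₀, complexBetti.map (fiberι ((baseChangeHom σ).map f₀) t) (2 * p) W ∈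
      algebraicClasses (fiberOver ((baseChangeHom σ).map f₀) t) p := fun t ht ↦ by
    obtain ⟨A₀, hdim, ⟨e₀⟩⟩ := hchart t ht
    exact mem_algebraicClasses_of_qbarChart hQb A₀ e₀ hdim (hW t).1 (hW t).2
  -- Q spreads it to every fibre; transport along `e : A.X ≅ 𝒳_{s₁}`
  rw [← hWc]
  exact (mem_algebraicClasses_map_iff_of_iso e).2 (hQ σ f₀ A.dim h𝒳₀ hS₀ hirr₀ hirr hsm hf hab p W hW hq s₁)

/-- **EXACTNESS of row Q.** Granted the printed `ℚ̄`-families, `HC_AV ↔ HC_QbarAV ∧ Q`: both factors are consequences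
of `HC_AV` (part V `hodgeConjectureQbarAV_of_HC_AV`, §C). Neither factor is known to imply the other or `HC_AV`: a
genuine splitting (module docstring, HONEST COLUMN (1)). [cite: Voisin2007HodgeLoci, §3 proof of Prop. 1.2 (p. 6)] -/
theorem HC_AV_iff_hodgeConjectureQbarAV_and_qbarSpreading (hE : QbarHodgeFamilies) :
    HodgeAbelianVarieties ↔ HodgeConjectureQbarAV ∧ QbarSpreading :=
  ⟨fun h ↦ ⟨hodgeConjectureQbarAV_of_HC_AV h, qbarSpreading_of_HC_AV h⟩,
    fun h ↦ HC_AV_of_hodgeConjectureQbarAV_of_qbarSpreading hE h.1 h.2⟩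

/-- **UNDER THE ENDPOINT, Q IS THE WHOLE GAP**: granted `HC_QbarAV` (and `hE`), `Q ↔ HC_AV` — Hodge for all complex
abelian varieties is then EQUIVALENT to the `ℚ̄`-spreading statement. [cite: Voisin2007HodgeLoci, §3 proof of Prop. 1.2 (p. 6)] -/
theorem qbarSpreading_iff_HC_AV_of_hodgeConjectureQbarAV (hE : QbarHodgeFamilies) (hQb : HodgeConjectureQbarAV) :
    QbarSpreading ↔ HodgeAbelianVarieties :=
  ⟨HC_AV_of_hodgeConjectureQbarAV_of_qbarSpreading hE hQb, qbarSpreading_of_HC_AV⟩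

/-- **`Spread_AV ⟸ Q`** (part XV's geometric factor `CMIdle HC_QbarAV := HC_QbarAV → HC_AV` from the typed node, modulo
`hE`). The converse holds under the endpoint only (`qbarSpreading_iff_HC_AV_of_hodgeConjectureQbarAV`). [folklore] -/
theorem cmIdle_qbarAV_of_qbarSpreading (hE : QbarHodgeFamilies) (hQ : QbarSpreading) : CMIdle HodgeConjectureQbarAV :=
  fun hQb ↦ HC_AV_of_hodgeConjectureQbarAV_of_qbarSpreading hE hQb hQ

/-- In the LEAD's 2×2 grid (`Ring2AbelianAllFrameCrossBranch`): modulo `hE`, `HC_QbarAV ∧ Q` is a PIVOT (`CMIdle` and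
`OnPathAV`, i.e. `↔ HC_AV`) — `HC_CM`-free. [folklore] -/
theorem pivotAV_qbarAV_and_qbarSpreading (hE : QbarHodgeFamilies) : PivotAV (HodgeConjectureQbarAV ∧ QbarSpreading) :=
  pivotAV_iff.2 (HC_AV_iff_hodgeConjectureQbarAV_and_qbarSpreading hE).symm

/-! ## §E `HC_CM` ROWS: the arithmetic axis reaches `HC_AV` — `HC_CM ∧ L(𝔇) ∧ Q`, exactness, and the item exactly -/

/-- **ROW CM-Q — `HC_AV_of_HC_CM_of_spanLifting_of_qbarSpreading`.** `HC_CM ∧ L(𝔇) ∧ Q ⟹ HC_AV` modulo the printed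
junction `hJ` ([Milne1999, Thm 7.1] + [Deligne1982HodgeCycles, 2.9(b)]: under `HC_CM`, Hodge classes on abelian
varieties over `ℚ̄` specialise to algebraic classes) and `hE`: part V's row A gives `HC_QbarAV` from `HC_CM` and span
lifting at almost all primes; row Q spreads it to `ℂ`. `HC_CM` is LOAD-BEARING (through Milne's theorem) and a
hypothesis BY NAME. [cite: Milne1999, §7 Thm. 7.1] [cite: Deligne1982HodgeCycles, 2.9(b)] [cite: Voisin2007HodgeLoci, §3 (p. 6)] -/
theorem HC_AV_of_HC_CM_of_spanLifting_of_qbarSpreading (𝔇 : RealizationFamily)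
    (hJ : CMAbelianHodge → SpecialisationsAlgebraicAV 𝔇) (hE : QbarHodgeFamilies) (hCM : CMAbelianHodge)
    (hL : SpanLiftingAtAlmostAllPrimesAV 𝔇) (hQ : QbarSpreading) : HodgeAbelianVarieties :=
  HC_AV_of_hodgeConjectureQbarAV_of_qbarSpreading hE (HC_QbarAV_of_HC_CM_and_spanLifting 𝔇 hJ hCM hL) hQ

/-- **EXACTNESS on the arithmetic axis.** Modulo [`hJ`, `hE`] (both print): `HC_AV ↔ HC_CM ∧ L(𝔇) ∧ Q` — every factor a
consequence of `HC_AV` (`HC_CM_of_HC_AV`; `L` through `HC_QbarAV`, part V; Q, §C), `HC_CM` not known to follow from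
`L ∧ Q`, nor `HC_AV` from any two of the three. No descent `hdesc` is needed. [cite: Milne1999, §7 Thm. 7.1]
[cite: Voisin2007HodgeLoci, §3 (p. 6)] -/
theorem HC_AV_iff_HC_CM_and_spanLifting_and_qbarSpreading (𝔇 : RealizationFamily)
    (hJ : CMAbelianHodge → SpecialisationsAlgebraicAV 𝔇) (hE : QbarHodgeFamilies) :
    HodgeAbelianVarieties ↔ CMAbelianHodge ∧ (SpanLiftingAtAlmostAllPrimesAV 𝔇 ∧ QbarSpreading) :=
  ⟨fun h ↦ ⟨HC_CM_of_HC_AV h, spanLiftingAtAlmostAllPrimesAV_of_hodgeConjectureQbarAV (hodgeConjectureQbarAV_of_HC_AV h),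
      qbarSpreading_of_HC_AV h⟩,
    fun h ↦ HC_AV_of_HC_CM_of_spanLifting_of_qbarSpreading 𝔇 hJ hE h.1 h.2.1 h.2.2⟩

/-- The same in the LEAD's grammar: `ExactWithCM (L(𝔇) ∧ Q)` and `ClosesWithCM (L(𝔇) ∧ Q)` modulo [`hJ`, `hE`]
(`ClosesWithCM Q` alone is NOT claimed: next to `HC_CM`, Q needs the Tate-side lifting). [cite: Milne1999, §7 Thm. 7.1] -/
theorem exactWithCM_spanLifting_and_qbarSpreading (𝔇 : RealizationFamily)
    (hJ : CMAbelianHodge → SpecialisationsAlgebraicAV 𝔇) (hE : QbarHodgeFamilies) :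
    ExactWithCM (SpanLiftingAtAlmostAllPrimesAV 𝔇 ∧ QbarSpreading) ∧
      ClosesWithCM (SpanLiftingAtAlmostAllPrimesAV 𝔇 ∧ QbarSpreading) :=
  ⟨HC_AV_iff_HC_CM_and_spanLifting_and_qbarSpreading 𝔇 hJ hE,
    fun hCM h ↦ HC_AV_of_HC_CM_of_spanLifting_of_qbarSpreading 𝔇 hJ hE hCM h.1 h.2⟩

/-- **ROW CM-Q, rational form**: `HC_CM ∧ R₁(𝔇) ∧ Q ⟹ HC_AV` modulo the special-lift junction `hJ'`
([Milne2009RationalTate, Aside 4.6] + [Kisin2017]), the classical `hgood` (smooth proper models at almost all primes)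
and `hE` (part V's row A′, then row Q). [cite: Milne2009RationalTate, Aside 4.6] [cite: Voisin2007HodgeLoci, §3 (p. 6)] -/
theorem HC_AV_of_HC_CM_of_rationalLifting_of_qbarSpreading (𝔇 : RealizationFamily)
    (hJ' : CMAbelianHodge → SpecialisationsRationalAV 𝔇)
    (hgood : ∀ A : AbelianVariety (IntermediateField.toSubfield (algebraicClosure ℚ ℂ)), ∃ F : Finset ℕ,
      ∀ p : ℕ, p.Prime → p ∉ F →
        ∃ (O : ValuationSubring (IntermediateField.toSubfield (algebraicClosure ℚ ℂ)))
          (_ : CharP (IsLocalRing.ResidueField O) p)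
          (𝒜 : IntegralModel O (IntermediateField.toSubfield (algebraicClosure ℚ ℂ)) A.X), 𝒜.IsSmoothProper A.dim)
    (hE : QbarHodgeFamilies) (hCM : CMAbelianHodge) (hR : RationalLiftingAtOnePrimeAV 𝔇) (hQ : QbarSpreading) :
    HodgeAbelianVarieties :=
  HC_AV_of_hodgeConjectureQbarAV_of_qbarSpreading hE (HC_QbarAV_of_HC_CM_and_rationalLifting 𝔇 hJ' hgood hCM hR) hQ

/-- **Toward the item**: `(HC_CM → L(𝔇)) ∧ Q ⟹ CMToAbelian` modulo [`hJ`, `hE`] (a typed conditional toward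
stmt-HodgeConjecture-16267, which stays OPEN). [cite: Milne1999, §7 Thm. 7.1] -/
theorem cmToAbelian_of_modCM_spanLifting_of_qbarSpreading (𝔇 : RealizationFamily)
    (hJ : CMAbelianHodge → SpecialisationsAlgebraicAV 𝔇) (hE : QbarHodgeFamilies)
    (hL : ModCM (SpanLiftingAtAlmostAllPrimesAV 𝔇)) (hQ : QbarSpreading) : CMToAbelian :=
  fun hCM A _ ↦ HC_AV_of_HC_CM_of_spanLifting_of_qbarSpreading 𝔇 hJ hE hCM (hL hCM) hQ A

/-- **THE ITEM EXACTLY** (modulo the print chains `hJ`, `hE`; no descent needed): `CMToAbelian ↔ ModCM (L(𝔇) ∧ Q)` —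
the reduction "HC_CM ⟹ HC(all abelian varieties)" IS "under `HC_CM`: span lifting at almost all primes for abelian
varieties over `ℚ̄` (ARITHMETIC, Tate side) and `ℚ̄`-spreading (GEOMETRIC)". `→`: under `HC_CM` the item gives `HC_AV`,
whence `L` (part V) and Q (§C). `←`: row CM-Q. Compare part XV's `CMToAbelian ↔ Spread_AV ∧ ModCM L`: the opaque
`Spread_AV` is replaced by the typed Q, at the price of Q appearing under `HC_CM`. [cite: Milne1999, §7 Thm. 7.1]
[cite: Voisin2007HodgeLoci, §3 (p. 6)] -/
theorem cmToAbelian_iff_modCM_spanLifting_and_qbarSpreading (𝔇 : RealizationFamily)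
    (hJ : CMAbelianHodge → SpecialisationsAlgebraicAV 𝔇) (hE : QbarHodgeFamilies) :
    CMToAbelian ↔ ModCM (SpanLiftingAtAlmostAllPrimesAV 𝔇 ∧ QbarSpreading) :=
  ⟨fun hT hCM ↦
      have hAV : HodgeAbelianVarieties := closesWithCM_cmToAbelian hCM hT
      ⟨spanLiftingAtAlmostAllPrimesAV_of_hodgeConjectureQbarAV (hodgeConjectureQbarAV_of_HC_AV hAV),
        qbarSpreading_of_HC_AV hAV⟩,
    fun h hCM A _ ↦ HC_AV_of_HC_CM_of_spanLifting_of_qbarSpreading 𝔇 hJ hE hCM (h hCM).1 (h hCM).2 A⟩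

/-- ON PATH (C6 audit): the summit statement gives every OPEN node of this file that is a case of it — Q — and the
conclusions of every row; `QbarHodgeFamilies` is a theorem in print, not a case of HC (HC supplies algebraic, not
`ℚ̄`-structured, families), so it has no on-path lemma, exactly as `CMDenseMumfordTateFamilies`. [folklore] -/
theorem qbarSpreading_nodes_of_hodgeConjecture (h : _root_.HodgeConjecture) :
    QbarSpreading ∧ HodgeConjectureQbarAV ∧ HodgeAbelianVarieties :=
  ⟨qbarSpreading_of_hodgeConjecture h, hodgeConjectureQbarAV_of_hodgeConjecture h, HC_AV_of_hodgeConjecture h⟩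

end Summit.HodgeConjecture.HodgeConjecture.Ring2.Deform
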